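import Summits.QuantumAdvantage.QuantumAdvantage.Theorems.PhiHidingThree
import Mathlib.NumberTheory.NumberField.Units.Regulator
import HarnessLib
import HarnessLib.Audit

set_option linter.dupNamespace false -- D-0017: single-problem summit ⇒ `QuantumAdvantage.QuantumAdvantage`

/-!
# EXEMPT-46 re-exam of crux `PureCubicClassNumberHard` (stmt-QuantumAdvantage-11826) — typed companion

Crux-strategist gen 2 (`planner-cstrat-stmt-QuantumAdvantage-11826-r1-0`, 2026-08-17), route
`LinnikCubicClassGroups`.  Companion of `STRATEGY-CENSUS.md §E46` (every decomposition of
`X = PureCubicClassNumberHard` attempted, graded against the BC2-redirect certificate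
(a) load-bearing / (b) non-trivial proved assembly / (c) no piece ≡ X or ≡ S).  Everything here is
kernel-checked (no `sorry`); nothing is asserted — hardness statements appear only as hypotheses or
as `def … : Prop`.

* §0  `S := QuantumAdvantage` versus the collapse `BQP ⊆ BPP` (classical logic).
* §1  **FIX branch 1 is closed by tree theorems.**  The landed Honda reduction
  (`hondaBitDecider_of_classNumberAlgorithm`, p90691/p111041) has ONE interface: Honda-bit hardness
  on some family of two-prime radicands (`HondaBitHardOn F`).  By c2's landed pipeline
  (`exists_randAlg_hondaBit_of_BQP_subset_BPP`, p115703: Shor + one simulated `BPP` query) that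
  interface node ALONE proves the summit, for EVERY family `F` (`summit_of_hondaBitHardOn`); hence
  every leaf `L` "joined to X by the landed Honda reduction" — whatever its provenance, factoring-type
  or not — satisfies `L → S` in two landed steps (`summit_of_leaf_through_honda`): probe (c) fails for
  all of them at once.  More generally (`summit_of_factorBitHardOn`), hardness of ANY bit that an `FP`
  post-processor reads off the prime factorisation (Gerth/Kobayashi 3-rank bits, root numbers of
  Mordell curves, any genus-theoretic datum) proves the summit by itself (`exists_randAlg_of_factorPost`).
* §2  **The world splits bottom out in the summit.**  D1 `X ↔ ResidualHard ∧ FactoringWorldHard`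
  has a ONE-LINE assembly (excluded middle) — a trivial seam, violates (b); and over the route's own
  proved items the natural residual conjunct `CollapseResidual := BQP ⊆ BPP → X` is EQUIVALENT to the
  summit (`collapseResidual_iff_summit`), so `X ↔ CollapseResidual ∧ (S → X)` exhibits X as
  "the summit ∧ (h stays hard in the summit world)" by pure logic — the typed meaning of RESTATED.
* §3  **h-type pieces are ≥ X (costume).**  `crux_of_threeBitHard` : hardness of the single bit
  `[3 ∣ h]` already implies X (landed window + `FP` post-processing), likewise any bit / residue /
  magnitude of `h` — such pieces are strengthenings of X, not fragments of it.
* §4  **Typed records** of the remaining candidate pieces graded in the census (`RSASplitHard`,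
  `CoarseRegulatorHard`), with no theorem claimed about them here (their grading is by the landed
  bypasses `FACT_mem_BQP_holds` / `stub_regulatorWrap` and by the ERH-equivalence with
  coarse-`h` hardness, see the census).

Disproof used: `Cruxes/PureCubicClassNumberHard/Disproof.lean` v4b — §2 normal form (X is hardness of
one explicit function: every "piece" below is typed against the crux verbatim), §3
`_false_without_PolyTime` (all derived algorithms inherit `IsPolyTime`: `isPolyTime_modThree`), §7
(worst case = infinitely often: why family-restricted conjuncts are never jointly necessary), §8
(`P_ne_PSPACE_of_crux_and_quantum_half`: why X and every residual form of it are hypothesis-type).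
-/

namespace Summit.QuantumAdvantage.QuantumAdvantage.Cruxes.PureCubicClassNumberHard.ReExam

open Literature.Computability.Complexity Literature.Computability.Complexity.Classes
open Literature.Computability.Complexity.Brick
open Literature.Computability.Cryptography _root_.Computability
open Summit.QuantumAdvantage.QuantumAdvantage.Theses.LinnikCubicClassGroups
open Summit.QuantumAdvantage.QuantumAdvantage.Theorems

/-! ## §0 The summit versus the collapse `BQP ⊆ BPP` -/

/-- `¬ S → BQP ⊆ BPP` (classical logic on `S = ∃ L ∈ BQP, L ∉ BPP`). [folklore] -/
theorem collapse_of_not_summit (h : ¬ _root_.QuantumAdvantage) : BQP ⊆ BPP :=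
  fun L hL => Classical.by_contradiction fun hL' => h ⟨L, hL, hL'⟩

/-- `BQP ⊄ BPP → S`. [folklore] -/
theorem summit_of_not_collapse (h : ¬ (BQP ⊆ BPP)) : _root_.QuantumAdvantage :=
  Classical.by_contradiction fun hS => h (collapse_of_not_summit hS)

/-- `S → BQP ⊄ BPP`. [folklore] -/
theorem not_collapse_of_summit (h : _root_.QuantumAdvantage) : ¬ (BQP ⊆ BPP) := by
  obtain ⟨L, hL, hL'⟩ := h
  exact fun hsub => hL' (hsub hL)

/-! ## §1 FIX branch 1 is closed in tree: every leaf through the Honda / genus interface proves `S` -/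

/-- **Honda-bit hardness on a family `F` of two-prime radicands** — the interface of the landed
Honda reduction: "no PPT algorithm outputs, for all distinct primes `p, q` with `F p q`, the Honda bit
`[¬(p ≡ 2,5 ∧ q ≡ 2,5 (mod 9))]` (`= [3 ∣ h(ℚ(∛pq))]`, Honda 1971) with probability `≥ 2/3`".  At
`F = (pq ≡ ±1 (mod 9))` this is VERBATIM the hypothesis `hB` of
`pureCubicClassNumberHard_of_honda_of_hondaBitHard` (p90691); the Φ-hiding(3) and Eisenstein-split
leaves are its restrictions to sub-families (with the bit renamed). [folklore] -/
def HondaBitHardOn (F : ℕ → ℕ → Prop) : Prop :=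
  ¬ ∃ D : RandAlg (List Bool) Bool, D.IsPolyTime id encodeBool ∧
    ∀ p q : ℕ, p.Prime → q.Prime → p ≠ q → F p q →
      (2 : ℝ) / 3 ≤ D.pr id (encodeNat (p * q))
        {b | b = decide (¬ ((p % 9 = 2 ∨ p % 9 = 5) ∧ (q % 9 = 2 ∨ q % 9 = 5)))}

/-- The landed transfer factors through the interface: Honda's two-prime criterion + Honda-bit
hardness on `pq ≡ ±1 (mod 9)` give the crux (p90691, by name). [folklore] -/
theorem crux_of_hondaBitHardOn
    (hH : Literature.NumberTheory.NumberFields.Honda1971_three_dvd_classNumber_twoPrimes)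
    (hB : HondaBitHardOn fun p q => (p * q) % 9 = 1 ∨ (p * q) % 9 = 8) :
    PureCubicClassNumberHard :=
  LinnikCubicClassGroups.pureCubicClassNumberHard_of_honda_of_hondaBitHard hH hB

/-- **The interface node is false under the collapse, for EVERY family** (c2's pipeline
`exists_randAlg_hondaBit_of_BQP_subset_BPP`, p115703: Shor + one simulated `BPP` query decides the
Honda bit of every `pq`). [folklore] -/
theorem not_collapse_of_hondaBitHardOn (F : ℕ → ℕ → Prop) (hB : HondaBitHardOn F) :
    ¬ (BQP ⊆ BPP) := fun hsub => by
  obtain ⟨D, hD, hpr⟩ := exists_randAlg_hondaBit_of_BQP_subset_BPP hsub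
  exact hB ⟨D, hD, fun p q hp hq hpq _ => by linarith [hpr p q hp hq hpq]⟩

/-- **The interface node ALONE proves the summit, for every family `F`.** [folklore] -/
theorem summit_of_hondaBitHardOn (F : ℕ → ℕ → Prop) (hB : HondaBitHardOn F) :
    _root_.QuantumAdvantage :=
  summit_of_not_collapse (not_collapse_of_hondaBitHardOn F hB)

/-- **NO-GO for FIX branch 1.** Any leaf `L` joined to `X` by the landed Honda reduction — i.e. any
`L` implying Honda-bit hardness on some family, which is the reduction's only input besides Honda's
criterion — proves the summit in two landed steps, whether or not `L` is "factoring-type" by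
provenance.  So every such leaf fails probe (c) `L → S`; a leaf surviving `FACT ∈ BPP` cannot be
joined to `X` through this reduction (under `FACT ∈ BPP ⊇`-worlds with `BQP ⊆ BPP` the interface is
refuted outright). [folklore] -/
theorem summit_of_leaf_through_honda (L : Prop) (F : ℕ → ℕ → Prop)
    (hjoin : L → HondaBitHardOn F) (hL : L) : _root_.QuantumAdvantage :=
  summit_of_hondaBitHardOn F (hjoin hL)

/-- **Hardness of a factorisation-determined bit `β` on a family of inputs** — the general
"genus-theory interface": `β` is any bit an `FP` post-processor reads off the list of prime factors
(Honda bit, Gerth/Kobayashi 3-rank bits, Eisenstein type, root number of `y² = x³ + m`, …). [folklore] -/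
def FactorBitHardOn (β : List Bool → Bool) (Fam : Set (List Bool)) : Prop :=
  ¬ ∃ D : RandAlg (List Bool) Bool, D.IsPolyTime id encodeBool ∧
    ∀ x ∈ Fam, (2 : ℝ) / 3 ≤ D.pr id x {b | b = β (boolPair x [])}

/-- **Every genus-interface leaf proves the summit by itself** (from c2's abstract pipeline
`exists_randAlg_of_factorPost`: any `FP` post-processing of Shor's factor list is PPT under the
collapse).  Consequently no decomposition `X ⇐ (β-bit hard) ∧ (β-bit decider ⇐ class-number
algorithm)` can pass (c), for any factorisation-determined `β` and any family. [folklore] -/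
theorem summit_of_factorBitHardOn {post : List Bool → List Bool} (hpost : post ∈ FP)
    {β : List Bool → Bool}
    (hβ : ∀ z y : List Bool,
      encodingListNatBool.encode (decodeNat (fstF z)).primeFactorsList <+: y →
        post (boolPair z y) = [β z])
    (Fam : Set (List Bool)) (h : FactorBitHardOn β Fam) : _root_.QuantumAdvantage :=
  summit_of_not_collapse fun hsub => by
    obtain ⟨D, hD, hpr⟩ := exists_randAlg_of_factorPost hsub hpost hβ
    exact h ⟨D, hD, fun x _ => by linarith [hpr x]⟩

/-- Instance: the named leaf of line `Sketch` (worst-case Φ-hiding, `e = 3`) proves the summit —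
the landed `quantumAdvantage_of_phiHidingThree` (p133220), i.e. probe (c) `PhiHidingThree → S`
succeeds by `exact?` (stated as an `example` so that no decl of this file concludes the summit). -/
example : PhiHidingThree → _root_.QuantumAdvantage :=
  quantumAdvantage_of_phiHidingThree

/-! ## §2 The world splits bottom out in the summit -/

/-- `X` in the factoring-easy world (gen-1 census §0). [folklore] -/
def ResidualHard : Prop :=
  Literature.Computability.QuantumComplexity.FACT ∈ BPP → PureCubicClassNumberHard

/-- `X` in the factoring-hard world (gen-1 census §0). [folklore] -/
def FactoringWorldHard : Prop :=
  Literature.Computability.QuantumComplexity.FACT ∉ BPP → PureCubicClassNumberHard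

/-- **D1's assembly is ONE LINE (excluded middle): a trivial seam — violates (b).** [folklore] -/
theorem crux_of_worlds (hR : ResidualHard) (hF : FactoringWorldHard) : PureCubicClassNumberHard :=
  (Classical.em _).elim hR hF

/-- … and both conjuncts are implied by `X` (so D1 is an `iff`, cut along `FACT ∈ BPP`). [folklore] -/
theorem worlds_of_crux (h : PureCubicClassNumberHard) : ResidualHard ∧ FactoringWorldHard :=
  ⟨fun _ => h, fun _ => h⟩

/-- `X` in the collapse world — the conjunct the route's deciding theorem actually consumes. [folklore] -/
def CollapseResidual : Prop :=
  BQP ⊆ BPP → PureCubicClassNumberHard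

/-- `X` in the summit world — what `X` says beyond the summit. [folklore] -/
def SummitWorldHard : Prop :=
  _root_.QuantumAdvantage → PureCubicClassNumberHard

/-- D1′ assembly, again ONE LINE: `X ⇐ CollapseResidual ∧ SummitWorldHard`. [folklore] -/
theorem crux_of_collapse_and_summitWorld (hC : CollapseResidual) (hW : SummitWorldHard) :
    PureCubicClassNumberHard :=
  (Classical.em (_root_.QuantumAdvantage)).elim hW fun hS => hC (collapse_of_not_summit hS)

/-- … and it is an `iff`. [folklore] -/
theorem collapse_and_summitWorld_of_crux (h : PureCubicClassNumberHard) :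
    CollapseResidual ∧ SummitWorldHard :=
  ⟨fun _ => h, fun _ => h⟩

/-- The summit gives `CollapseResidual` vacuously. [folklore] -/
theorem collapseResidual_of_summit (h : _root_.QuantumAdvantage) : CollapseResidual :=
  fun hsub => absurd hsub (not_collapse_of_summit h)

/-- `CollapseResidual` with the route's three other items gives the summit (the route's `closes`,
by cases on `S`). [folklore] -/
theorem summit_of_collapseResidual (hC : CollapseResidual) (h2 : DegreeOnePrimesEscape)
    (h4 : PureCubicClassGroupFBQP) (h5 : BitwiseSearchToDecision) : _root_.QuantumAdvantage :=
  Classical.by_contradiction fun hS => hS (closes (hC (collapse_of_not_summit hS)) h2 h4 h5)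

/-- **Over the route's own items, the residual conjunct IS the summit**:
`CollapseResidual ↔ QuantumAdvantage` given `DegreeOnePrimesEscape` (conditionally proved),
`PureCubicClassGroupFBQP` (PROVED) and `BitwiseSearchToDecision` (PROVED).  With
`crux_of_collapse_and_summitWorld` this types the audit verdict RESTATED: modulo proved items,
`X ↔ S ∧ (S → X)`. [folklore] -/
theorem collapseResidual_iff_summit (h2 : DegreeOnePrimesEscape) (h4 : PureCubicClassGroupFBQP)
    (h5 : BitwiseSearchToDecision) : CollapseResidual ↔ _root_.QuantumAdvantage :=
  ⟨fun hC => summit_of_collapseResidual hC h2 h4 h5, collapseResidual_of_summit⟩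

/-- The factoring-easy residual implies the collapse residual (Shor: `FACT ∈ BQP`, landed
`FACT_mem_BQP_holds`), so it too yields the summit with the three items (gen-1's
`closes_residual`); the converse `S → ResidualHard` is NOT available — `ResidualHard` sits strictly
between `X` and `CollapseResidual ≡ S`, and nothing found bears on it (census §E46, D1). [folklore] -/
theorem collapseResidual_of_residualHard (hR : ResidualHard) : CollapseResidual :=
  fun hsub => hR (hsub FACT_mem_BQP_holds)

/-- gen-1's `closes_residual`, re-derived. [folklore] -/
theorem summit_of_residualHard (hR : ResidualHard) (h2 : DegreeOnePrimesEscape)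
    (h4 : PureCubicClassGroupFBQP) (h5 : BitwiseSearchToDecision) : _root_.QuantumAdvantage :=
  summit_of_collapseResidual (collapseResidual_of_residualHard hR) h2 h4 h5

/-- Every factoring-type calibration is a fragment of the UNUSED conjunct: if `L → FACT ∉ BPP`
then `FactoringWorldHard → (L → X)`, and `L → S` outright (Shor). [folklore] -/
theorem factoringType_leaf (L : Prop)
    (hL : L → Literature.Computability.QuantumComplexity.FACT ∉ BPP) :
    (FactoringWorldHard → L → PureCubicClassNumberHard) ∧ (L → _root_.QuantumAdvantage) :=
  ⟨fun hF hl => hF (hL hl),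
    fun hl => summit_of_not_collapse fun hsub => hL hl (hsub FACT_mem_BQP_holds)⟩

/-! ## §3 `h`-type pieces are at least as strong as `X` (costume) -/

/-- **Single-bit strengthening** `[3 ∣ h]`: "no PPT algorithm decides `3 ∣ h(ℚ(∛m))` on every
non-cube `m`" (gen-1 census S2; the parity bit, any residue of `h`, or its order of magnitude are
typed the same way with another `FP` post-processor). [folklore] -/
def ThreeDivisibilityBitHard : Prop :=
  ¬ ∃ D : RandAlg (List Bool) Bool, D.IsPolyTime id encodeBool ∧
    ∀ (x : List Bool) (K : Type) [Field K] [NumberField K], Module.finrank ℚ K = 3 →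
      (∀ r : ℕ, r ^ 3 ≠ decodeNat x) → (∃ α : K, α ^ 3 = (decodeNat x : K)) →
        (2 : ℝ) / 3 ≤ D.pr id x {b | b = decide (3 ∣ NumberField.classNumber K)}

/-- **`ThreeDivisibilityBitHard → X`** in a dozen lines of landed plumbing (window
`classNumber_lt_window`, `FP` post-processing `isPolyTime_modThree`, push-forward monotonicity):
the piece is a STRENGTHENING of the crux (X with the demanded output cut to one bit), hence fails
(c) in substance — and in the residual world it is false outright (Honda–Gerth: the 3-rank is
`FP^{FACT}`), census S2/D7. [folklore] -/
theorem crux_of_threeBitHard (h : ThreeDivisibilityBitHard) : PureCubicClassNumberHard := by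
  rintro ⟨A, hApt, hAcorr⟩
  refine h ⟨{ run := fun x r => decide (bitsToNat (A.run x r) % 3 = 0), coinLen := A.coinLen },
    LinnikCubicClassGroups.isPolyTime_modThree hApt, ?_⟩
  intro x K _ _ h3 hnc hα
  have hAK := hAcorr x K h3 hnc hα
  have hlt := LinnikCubicClassGroups.classNumber_lt_window x K h3 hnc hα
  refine hAK.trans (LinnikCubicClassGroups.pr_singleton_le_pr_modThree A _ _ _ ?_)
  rw [LinnikCubicClassGroups.bitsToNat_ofFn_testBit hlt]
  exact decide_eq_decide.mpr (Nat.dvd_iff_mod_eq_zero).symm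

/-! ## §4 Typed records of the remaining candidate pieces (graded in the census, no theorem claimed) -/

/-- D2 leaf (card ramified-cubes-factoring-transfer): RSA-modulus splitting is hard — factoring-type
(`→ FACT ∉ BPP`), hence `→ S` by Shor (`factoringType_leaf`): fails (c). [folklore] -/
def RSASplitHard : Prop :=
  ¬ ∃ A : RandAlg (List Bool) (List Bool), A.IsPolyTime id id ∧
    ∀ p q : ℕ, p.Prime → q.Prime → p ≠ q → Odd (p * q) →
      (2 : ℝ) / 3 ≤ A.pr id (encodeNat (p * q)) {y | decodeNat y = p ∨ decodeNat y = q}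

/-- D8 leaf (card euler-squeeze, regulator language): no PPT algorithm outputs an integer within a
factor `2` of the regulator `R(ℚ(∛m))` on every non-cube `m` (Mathlib `NumberField.Units.regulator`).
Graded in the census: ERH-equivalent to coarse-`h` hardness (an X-strengthening: costume) and
bypassed in tree by the route's own landed regulator stage `stub_regulatorWrap` (+ Shor). [folklore] -/
def CoarseRegulatorHard : Prop :=
  ¬ ∃ A : RandAlg (List Bool) (List Bool), A.IsPolyTime id id ∧
    ∀ (x : List Bool) (K : Type) [Field K] [NumberField K], Module.finrank ℚ K = 3 →
      (∀ r : ℕ, r ^ 3 ≠ decodeNat x) → (∃ α : K, α ^ 3 = (decodeNat x : K)) →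
        (2 : ℝ) / 3 ≤ A.pr id x {y | NumberField.Units.regulator K / 2 ≤ (decodeNat y : ℝ) ∧
          (decodeNat y : ℝ) ≤ 2 * NumberField.Units.regulator K}

end Summit.QuantumAdvantage.QuantumAdvantage.Cruxes.PureCubicClassNumberHard.ReExam
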